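import Summits.AtomisticToContinuum.HydrodynamicLimit.Theorems.RelayRaceLocalityNearConstantShortTimeHLTiltL2Assembly
import HarnessLib

/-!
# Crux `NearConstantShortTimeHL` (stmt-AtomisticToContinuum-12502) — ROUTE-LEVEL SPLIT into its four dynamical sub-cruxes
# (crux-strategist, `Theorems/RelayRaceLocalityNearConstantShortTimeHLSplit.lean`)

Support file (`--supports stmt-AtomisticToContinuum-12502`), written by the crux-strategist seat
planner-cstrat-stmt-AtomisticToContinuum-12502-s3-0 for the glued split (D-0019 / strategist output (b)) of the route item
`RelayRaceLocality.NearConstantShortTimeHL` into FOUR typed sub-cruxes. The statics side of the line `small-tilt-domination`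
(Yau's relative-entropy method for the dilute hard-sphere gas, general families) is CLOSED in the tree (`…TiltL2Assembly`, p144576:
`nearConstantShortTimeHL_of_dynamics4`), so the crux follows from the four DYNAMICAL conjectures alone:

* `Sub₁` = `MomentumClosureTightness4` (S2″) — EQUILIBRIUM momentum-closure tightness at a uniform rate under the invariant drifted
  Gibbs law, with speed cap, ball-packing cap and fourth-moment cap inside the event (`…MomentCapDefs`);
* `Sub₂` = `EnergyClosureTightness4` (S3″) — its energy twin;
* `Sub₃` = `TrueLawCapsG` (S4′) — a-priori caps along the TRUE law (speed cap, ball-packing cap, Gaussian velocity tails in mean;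
  `…AssemblyDefs`);
* `Sub₄` = `FourthMomentCapPreShock` (S4d) — the fourth-moment cap along the true law, pre-shock (`…MomentCapDefs`).

Because the route file `Theses/RelayRaceLocality.lean` cannot import `Theorems/…` (the Defs files import the route file), the four
children are re-stated here SELF-CONTAINED over `Literature` vocabulary — verbatim the bodies of the four `@[conjecture] def`s with
`speedCapOn` / `packCapOn` / `momentCapOn` / `momDefect` / `enDefect` / `mesoRadius` / `ballKernel` unfolded (the pattern of
`momentumClosureTightnessUR_iff … := Iff.rfl`, `…AssemblyTheta`). The four `_iff` lemmas below record that the inlined texts ARE the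
tree conjectures (definitional), and `NearConstantShortTimeHL_of_subs` is the glue `Sub₁ → Sub₂ → Sub₃ → Sub₄ → NearConstantShortTimeHL`
consumed by `ledger route edit … --split NearConstantShortTimeHL --glue-by`. No new mathematics.
References: H.-T. Yau, Lett. Math. Phys. 22 (1991) §2; S. Olla – S.R.S. Varadhan – H.-T. Yau, Comm. Math. Phys. 155 (1993) §§1–3.
-/

noncomputable section

namespace Summit.AtomisticToContinuum.HydrodynamicLimit.Theorems.NearConstantShortTimeHL

open scoped BigOperators ENNReal
open MeasureTheory Set Filter Topology
open Literature.MathematicalPhysics.KineticTheory Literature.Analysis.FluidPDE Literature.Analysis.FunctionSpaces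
open Summit.AtomisticToContinuum.HydrodynamicLimit.Theses.RelayRaceLocality (NearConstantShortTimeHL)

/-- **Sub₁ inlined = `MomentumClosureTightness4`** (definitional unfolding of `speedCapOn`, `packCapOn`, `momentCapOn`, `momDefect`,
`mesoRadius`, `ballKernel`). [folklore] -/
theorem momentumClosureTightness4_inlined_iff :
    (∃ η₁ : ℝ, 0 < η₁ ∧ ∀ M : ℝ, 1 ≤ M → ∀ K : ℝ, 0 < K → ∃ c₀ : ℝ, 0 < c₀ ∧ ∀ (abar θe : ℝ) (ubar : V3),
        M⁻¹ ≤ abar → abar ≤ M → M⁻¹ ≤ θe → θe ≤ M → ‖ubar‖ ≤ M →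
        ∃ σ₀ : ℝ, 0 < σ₀ ∧ ∀ σ : ℝ, 0 < σ → σ < σ₀ →
        ∀ (ε : ℕ → ℝ) (n : ℕ → ℕ), (∀ N, 0 < ε N) → Tendsto ε atTop (nhds 0) →
        Tendsto (fun N => (n N : ℝ) * ε N ^ 3) atTop (nhds (σ ^ 3)) →
        ∀ Φ : (N : ℕ) → HardSphereFlow (Torus.geometry (Fin 3)) (ε N) (n N),
        ∀ (s τ : ℝ), 0 ≤ s → 0 < τ → s + τ ≤ 1 →
        ∀ ψ : ℝ → T3 → V3, Torus.IsSmoothSpaceTimeOn (Set.Icc s (s + τ)) ψ →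
        (∀ r ∈ Set.Icc s (s + τ), ∀ x, ‖ψ r x‖ ≤ 1 ∧ ‖Torus.timeDerivWithin (Set.Icc s (s + τ)) ψ r x‖ ≤ 1 ∧
          ∀ i, ‖Torus.partialDeriv i (ψ r) x‖ ≤ 1) →
        ∀ δ : ℝ, 0 < δ → ∀ᶠ N : ℕ in atTop,
          particleLaw (Φ N) (canonicalDensity (Torus.geometry (Fin 3)) (ε N) (n N)
              (localGibbsProfile (fun _ => abar) (fun _ => ubar) (fun _ => θe)))
            {z | let ℓ : ℝ := (n N : ℝ) ^ (-(1 / 4 : ℝ));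
                 let χ : T3 → T3 → ℝ := fun x y => if Torus.euclidDist x y < ℓ then (4 / 3 * Real.pi * ℓ ^ 3)⁻¹ else 0;
                 let ρ : ℝ → T3 → ℝ := fun r x => empiricalDensityField ((Φ N).flow r z) (χ x);
                 let m : ℝ → T3 → V3 := fun r x => empiricalMomentumField ((Φ N).flow r z) (χ x);
                 let e : ℝ → T3 → ℝ := fun r x => empiricalEnergyField ((Φ N).flow r z) (χ x);
                 let p : ℝ → T3 → ℝ := fun r x => hsPressure σ (ρ r x) (2 / 3 * (e r x / ρ r x - ‖m r x‖ ^ 2 / (2 * ρ r x ^ 2)));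
                 let Mt : ℝ → (T3 → V3) → ℝ := fun r g => ∑ j, (empiricalMomentumField ((Φ N).flow r z) (fun y => g y j)) j;
                 (∀ r ∈ Set.Icc s (s + τ), ∀ i, ‖((Φ N).flow r z i).2‖ ≤ (n N : ℝ) ^ (1 / 24 : ℝ)) ∧
                 (∀ r ∈ Set.Icc s (s + τ), ∀ x, ρ r x * σ ^ 3 ≤ η₁) ∧
                 (∀ r ∈ Set.Icc s (s + τ), (n N : ℝ)⁻¹ * ∑ i, ‖((Φ N).flow r z i).2‖ ^ 4 ≤ K) ∧
                 δ < |Mt (s + τ) (ψ (s + τ)) - Mt s (ψ s) - ∫ r in s..(s + τ),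
                   (Mt r (Torus.timeDerivWithin (Set.Icc s (s + τ)) ψ r) +
                    ∫ x, ((∑ i, ∑ j, (Torus.partialDeriv i (ψ r) x) j * (m r x i * m r x j / ρ r x)) +
                      p r x * Torus.divergence (ψ r) x))|}
            ≤ ENNReal.ofReal (Real.exp (-(c₀ * n N)))) ↔ MomentumClosureTightness4 :=
  Iff.rfl

/-- **Sub₂ inlined = `EnergyClosureTightness4`** (definitional). [folklore] -/
theorem energyClosureTightness4_inlined_iff :
    (∃ η₁ : ℝ, 0 < η₁ ∧ ∀ M : ℝ, 1 ≤ M → ∀ K : ℝ, 0 < K → ∃ c₀ : ℝ, 0 < c₀ ∧ ∀ (abar θe : ℝ) (ubar : V3),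
        M⁻¹ ≤ abar → abar ≤ M → M⁻¹ ≤ θe → θe ≤ M → ‖ubar‖ ≤ M →
        ∃ σ₀ : ℝ, 0 < σ₀ ∧ ∀ σ : ℝ, 0 < σ → σ < σ₀ →
        ∀ (ε : ℕ → ℝ) (n : ℕ → ℕ), (∀ N, 0 < ε N) → Tendsto ε atTop (nhds 0) →
        Tendsto (fun N => (n N : ℝ) * ε N ^ 3) atTop (nhds (σ ^ 3)) →
        ∀ Φ : (N : ℕ) → HardSphereFlow (Torus.geometry (Fin 3)) (ε N) (n N),
        ∀ (s τ : ℝ), 0 ≤ s → 0 < τ → s + τ ≤ 1 →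
        ∀ φ : ℝ → T3 → ℝ, Torus.IsSmoothSpaceTimeOn (Set.Icc s (s + τ)) φ →
        (∀ r ∈ Set.Icc s (s + τ), ∀ x, |φ r x| ≤ 1 ∧ |Torus.timeDerivWithin (Set.Icc s (s + τ)) φ r x| ≤ 1 ∧
          ∀ i, |Torus.partialDeriv i (φ r) x| ≤ 1) →
        ∀ δ : ℝ, 0 < δ → ∀ᶠ N : ℕ in atTop,
          particleLaw (Φ N) (canonicalDensity (Torus.geometry (Fin 3)) (ε N) (n N)
              (localGibbsProfile (fun _ => abar) (fun _ => ubar) (fun _ => θe)))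
            {z | let ℓ : ℝ := (n N : ℝ) ^ (-(1 / 4 : ℝ));
                 let χ : T3 → T3 → ℝ := fun x y => if Torus.euclidDist x y < ℓ then (4 / 3 * Real.pi * ℓ ^ 3)⁻¹ else 0;
                 let ρ : ℝ → T3 → ℝ := fun r x => empiricalDensityField ((Φ N).flow r z) (χ x);
                 let m : ℝ → T3 → V3 := fun r x => empiricalMomentumField ((Φ N).flow r z) (χ x);
                 let e : ℝ → T3 → ℝ := fun r x => empiricalEnergyField ((Φ N).flow r z) (χ x);
                 let p : ℝ → T3 → ℝ := fun r x => hsPressure σ (ρ r x) (2 / 3 * (e r x / ρ r x - ‖m r x‖ ^ 2 / (2 * ρ r x ^ 2)));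
                 let Et : ℝ → (T3 → ℝ) → ℝ := fun r g => empiricalEnergyField ((Φ N).flow r z) g;
                 (∀ r ∈ Set.Icc s (s + τ), ∀ i, ‖((Φ N).flow r z i).2‖ ≤ (n N : ℝ) ^ (1 / 24 : ℝ)) ∧
                 (∀ r ∈ Set.Icc s (s + τ), ∀ x, ρ r x * σ ^ 3 ≤ η₁) ∧
                 (∀ r ∈ Set.Icc s (s + τ), (n N : ℝ)⁻¹ * ∑ i, ‖((Φ N).flow r z i).2‖ ^ 4 ≤ K) ∧
                 δ < |Et (s + τ) (φ (s + τ)) - Et s (φ s) - ∫ r in s..(s + τ),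
                   (Et r (Torus.timeDerivWithin (Set.Icc s (s + τ)) φ r) +
                    ∫ x, (e r x + p r x) * (∑ i, (m r x i / ρ r x) * (Torus.gradient (φ r) x) i))|}
            ≤ ENNReal.ofReal (Real.exp (-(c₀ * n N)))) ↔ EnergyClosureTightness4 :=
  Iff.rfl

/-- **Sub₃ inlined = `TrueLawCapsG`** (syntactically the same body). [folklore] -/
theorem trueLawCapsG_inlined_iff :
    (∀ η₁ : ℝ, 0 < η₁ → ∀ (a₀ θ₀ : T3 → ℝ) (u₀ : T3 → V3), Continuous a₀ → Continuous θ₀ → Continuous u₀ →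
        (∀ x, 0 < a₀ x) → (∀ x, 0 < θ₀ x) → ∃ σ₀ : ℝ, 0 < σ₀ ∧ ∀ σ : ℝ, 0 < σ → σ < σ₀ →
        ∀ (ε : ℕ → ℝ) (n : ℕ → ℕ), (∀ N, 0 < ε N) → Tendsto ε atTop (nhds 0) →
        Tendsto (fun N => (n N : ℝ) * ε N ^ 3) atTop (nhds (σ ^ 3)) →
        ∀ (T : ℝ) (ρ θ : ℝ → T3 → ℝ) (u : ℝ → T3 → V3), IsHardSphereEulerSolution σ T ρ u θ →
        ∀ Φ : (N : ℕ) → HardSphereFlow (Torus.geometry (Fin 3)) (ε N) (n N),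
        let P : (N : ℕ) → Measure (Config (n N) (Fin 3) T3) := fun N =>
          particleLaw (Φ N) (canonicalDensity (Torus.geometry (Fin 3)) (ε N) (n N) (localGibbsProfile a₀ u₀ θ₀));
        (∀ N, IsProbabilityMeasure (P N)) →
        (∀ χ : T3 → ℝ, Continuous χ → ∀ δ : ℝ, 0 < δ →
          Tendsto (fun N => P N {z | δ < |empiricalDensityField ((Φ N).flow 0 z) χ - ∫ x, χ x * ρ 0 x|}) atTop (nhds 0) ∧
          Tendsto (fun N => P N {z | δ < ‖empiricalMomentumField ((Φ N).flow 0 z) χ - ∫ x, (χ x * ρ 0 x) • u 0 x‖}) atTop (nhds 0) ∧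
          Tendsto (fun N => P N {z | δ < |empiricalEnergyField ((Φ N).flow 0 z) χ -
            ∫ x, χ x * totalEnergyDensity (ρ 0 x) (u 0 x) (θ 0 x)|}) atTop (nhds 0)) →
        ∀ t ∈ Set.Ico 0 T, (∀ s ∈ Set.Icc 0 t, ∀ x, ρ s x * σ ^ 3 ≤ η₁ / 2) →
          Tendsto (fun N => P N {z | ∃ r ∈ Set.Icc 0 t, ∃ i, (n N : ℝ) ^ (1 / 24 : ℝ) < ‖((Φ N).flow r z i).2‖})
            atTop (nhds 0) ∧
          Tendsto (fun N => P N {z | ∃ r ∈ Set.Icc 0 t, ∃ x : T3,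
            η₁ < empiricalDensityField ((Φ N).flow r z)
              (fun y => if Torus.euclidDist x y < (n N : ℝ) ^ (-(1 / 4 : ℝ))
                then (4 / 3 * Real.pi * ((n N : ℝ) ^ (-(1 / 4 : ℝ))) ^ 3)⁻¹ else 0) * σ ^ 3}) atTop (nhds 0) ∧
          (∃ a : ℝ, 0 < a ∧ ∃ A : ℝ, ∀ᶠ N : ℕ in atTop, ∀ s ∈ Set.Icc 0 t,
            ∫⁻ z, ENNReal.ofReal ((n N : ℝ)⁻¹ * ∑ i : Fin (n N), Real.exp (a * ‖((Φ N).flow s z i).2‖ ^ 2)) ∂(P N) ≤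
              ENNReal.ofReal A)) ↔ TrueLawCapsG :=
  Iff.rfl

/-- **Sub₄ inlined = `FourthMomentCapPreShock`** (syntactically the same body). [folklore] -/
theorem fourthMomentCapPreShock_inlined_iff :
    (∀ (a₀ θ₀ : T3 → ℝ) (u₀ : T3 → V3), Continuous a₀ → Continuous θ₀ → Continuous u₀ →
        (∀ x, 0 < a₀ x) → (∀ x, 0 < θ₀ x) → ∃ σ₀ : ℝ, 0 < σ₀ ∧ ∀ σ : ℝ, 0 < σ → σ < σ₀ →
        ∀ (ε : ℕ → ℝ) (n : ℕ → ℕ), (∀ N, 0 < ε N) → Tendsto ε atTop (nhds 0) →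
        Tendsto (fun N => (n N : ℝ) * ε N ^ 3) atTop (nhds (σ ^ 3)) →
        ∀ (T : ℝ) (ρ θ : ℝ → T3 → ℝ) (u : ℝ → T3 → V3), IsHardSphereEulerSolution σ T ρ u θ →
        ∀ Φ : (N : ℕ) → HardSphereFlow (Torus.geometry (Fin 3)) (ε N) (n N),
        let P : (N : ℕ) → Measure (Config (n N) (Fin 3) T3) := fun N =>
          particleLaw (Φ N) (canonicalDensity (Torus.geometry (Fin 3)) (ε N) (n N) (localGibbsProfile a₀ u₀ θ₀));
        (∀ N, IsProbabilityMeasure (P N)) →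
        (∀ χ : T3 → ℝ, Continuous χ → ∀ δ : ℝ, 0 < δ →
          Tendsto (fun N => P N {z | δ < |empiricalDensityField ((Φ N).flow 0 z) χ - ∫ x, χ x * ρ 0 x|}) atTop (nhds 0) ∧
          Tendsto (fun N => P N {z | δ < ‖empiricalMomentumField ((Φ N).flow 0 z) χ - ∫ x, (χ x * ρ 0 x) • u 0 x‖}) atTop (nhds 0) ∧
          Tendsto (fun N => P N {z | δ < |empiricalEnergyField ((Φ N).flow 0 z) χ -
            ∫ x, χ x * totalEnergyDensity (ρ 0 x) (u 0 x) (θ 0 x)|}) atTop (nhds 0)) →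
        ∀ t ∈ Set.Ico 0 T, ∀ K : ℝ,
          (∀ s ∈ Set.Icc 0 t, ∀ x, ‖u s x‖ ^ 4 + 10 * θ s x * ‖u s x‖ ^ 2 + 15 * θ s x ^ 2 < K) →
          Tendsto (fun N => P N {z | ∃ r ∈ Set.Icc 0 t,
            K < (n N : ℝ)⁻¹ * ∑ i : Fin (n N), ‖((Φ N).flow r z i).2‖ ^ 4}) atTop (nhds 0)) ↔ FourthMomentCapPreShock :=
  Iff.rfl

/-- **THE GLUE OF THE ROUTE-LEVEL SPLIT**: the four dynamical sub-cruxes (stated self-contained, as they are written into the route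
file) imply the crux `RelayRaceLocality.NearConstantShortTimeHL` — `nearConstantShortTimeHL_of_dynamics4` through the four
definitional `_iff`s. [cite: Yau1991, §2] -/
theorem NearConstantShortTimeHL_of_subs :
    (∃ η₁ : ℝ, 0 < η₁ ∧ ∀ M : ℝ, 1 ≤ M → ∀ K : ℝ, 0 < K → ∃ c₀ : ℝ, 0 < c₀ ∧ ∀ (abar θe : ℝ) (ubar : V3),
        M⁻¹ ≤ abar → abar ≤ M → M⁻¹ ≤ θe → θe ≤ M → ‖ubar‖ ≤ M →
        ∃ σ₀ : ℝ, 0 < σ₀ ∧ ∀ σ : ℝ, 0 < σ → σ < σ₀ →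
        ∀ (ε : ℕ → ℝ) (n : ℕ → ℕ), (∀ N, 0 < ε N) → Tendsto ε atTop (nhds 0) →
        Tendsto (fun N => (n N : ℝ) * ε N ^ 3) atTop (nhds (σ ^ 3)) →
        ∀ Φ : (N : ℕ) → HardSphereFlow (Torus.geometry (Fin 3)) (ε N) (n N),
        ∀ (s τ : ℝ), 0 ≤ s → 0 < τ → s + τ ≤ 1 →
        ∀ ψ : ℝ → T3 → V3, Torus.IsSmoothSpaceTimeOn (Set.Icc s (s + τ)) ψ →
        (∀ r ∈ Set.Icc s (s + τ), ∀ x, ‖ψ r x‖ ≤ 1 ∧ ‖Torus.timeDerivWithin (Set.Icc s (s + τ)) ψ r x‖ ≤ 1 ∧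
          ∀ i, ‖Torus.partialDeriv i (ψ r) x‖ ≤ 1) →
        ∀ δ : ℝ, 0 < δ → ∀ᶠ N : ℕ in atTop,
          particleLaw (Φ N) (canonicalDensity (Torus.geometry (Fin 3)) (ε N) (n N)
              (localGibbsProfile (fun _ => abar) (fun _ => ubar) (fun _ => θe)))
            {z | let ℓ : ℝ := (n N : ℝ) ^ (-(1 / 4 : ℝ));
                 let χ : T3 → T3 → ℝ := fun x y => if Torus.euclidDist x y < ℓ then (4 / 3 * Real.pi * ℓ ^ 3)⁻¹ else 0;
                 let ρ : ℝ → T3 → ℝ := fun r x => empiricalDensityField ((Φ N).flow r z) (χ x);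
                 let m : ℝ → T3 → V3 := fun r x => empiricalMomentumField ((Φ N).flow r z) (χ x);
                 let e : ℝ → T3 → ℝ := fun r x => empiricalEnergyField ((Φ N).flow r z) (χ x);
                 let p : ℝ → T3 → ℝ := fun r x => hsPressure σ (ρ r x) (2 / 3 * (e r x / ρ r x - ‖m r x‖ ^ 2 / (2 * ρ r x ^ 2)));
                 let Mt : ℝ → (T3 → V3) → ℝ := fun r g => ∑ j, (empiricalMomentumField ((Φ N).flow r z) (fun y => g y j)) j;
                 (∀ r ∈ Set.Icc s (s + τ), ∀ i, ‖((Φ N).flow r z i).2‖ ≤ (n N : ℝ) ^ (1 / 24 : ℝ)) ∧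
                 (∀ r ∈ Set.Icc s (s + τ), ∀ x, ρ r x * σ ^ 3 ≤ η₁) ∧
                 (∀ r ∈ Set.Icc s (s + τ), (n N : ℝ)⁻¹ * ∑ i, ‖((Φ N).flow r z i).2‖ ^ 4 ≤ K) ∧
                 δ < |Mt (s + τ) (ψ (s + τ)) - Mt s (ψ s) - ∫ r in s..(s + τ),
                   (Mt r (Torus.timeDerivWithin (Set.Icc s (s + τ)) ψ r) +
                    ∫ x, ((∑ i, ∑ j, (Torus.partialDeriv i (ψ r) x) j * (m r x i * m r x j / ρ r x)) +
                      p r x * Torus.divergence (ψ r) x))|}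
            ≤ ENNReal.ofReal (Real.exp (-(c₀ * n N)))) →
    (∃ η₁ : ℝ, 0 < η₁ ∧ ∀ M : ℝ, 1 ≤ M → ∀ K : ℝ, 0 < K → ∃ c₀ : ℝ, 0 < c₀ ∧ ∀ (abar θe : ℝ) (ubar : V3),
        M⁻¹ ≤ abar → abar ≤ M → M⁻¹ ≤ θe → θe ≤ M → ‖ubar‖ ≤ M →
        ∃ σ₀ : ℝ, 0 < σ₀ ∧ ∀ σ : ℝ, 0 < σ → σ < σ₀ →
        ∀ (ε : ℕ → ℝ) (n : ℕ → ℕ), (∀ N, 0 < ε N) → Tendsto ε atTop (nhds 0) →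
        Tendsto (fun N => (n N : ℝ) * ε N ^ 3) atTop (nhds (σ ^ 3)) →
        ∀ Φ : (N : ℕ) → HardSphereFlow (Torus.geometry (Fin 3)) (ε N) (n N),
        ∀ (s τ : ℝ), 0 ≤ s → 0 < τ → s + τ ≤ 1 →
        ∀ φ : ℝ → T3 → ℝ, Torus.IsSmoothSpaceTimeOn (Set.Icc s (s + τ)) φ →
        (∀ r ∈ Set.Icc s (s + τ), ∀ x, |φ r x| ≤ 1 ∧ |Torus.timeDerivWithin (Set.Icc s (s + τ)) φ r x| ≤ 1 ∧
          ∀ i, |Torus.partialDeriv i (φ r) x| ≤ 1) →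
        ∀ δ : ℝ, 0 < δ → ∀ᶠ N : ℕ in atTop,
          particleLaw (Φ N) (canonicalDensity (Torus.geometry (Fin 3)) (ε N) (n N)
              (localGibbsProfile (fun _ => abar) (fun _ => ubar) (fun _ => θe)))
            {z | let ℓ : ℝ := (n N : ℝ) ^ (-(1 / 4 : ℝ));
                 let χ : T3 → T3 → ℝ := fun x y => if Torus.euclidDist x y < ℓ then (4 / 3 * Real.pi * ℓ ^ 3)⁻¹ else 0;
                 let ρ : ℝ → T3 → ℝ := fun r x => empiricalDensityField ((Φ N).flow r z) (χ x);
                 let m : ℝ → T3 → V3 := fun r x => empiricalMomentumField ((Φ N).flow r z) (χ x);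
                 let e : ℝ → T3 → ℝ := fun r x => empiricalEnergyField ((Φ N).flow r z) (χ x);
                 let p : ℝ → T3 → ℝ := fun r x => hsPressure σ (ρ r x) (2 / 3 * (e r x / ρ r x - ‖m r x‖ ^ 2 / (2 * ρ r x ^ 2)));
                 let Et : ℝ → (T3 → ℝ) → ℝ := fun r g => empiricalEnergyField ((Φ N).flow r z) g;
                 (∀ r ∈ Set.Icc s (s + τ), ∀ i, ‖((Φ N).flow r z i).2‖ ≤ (n N : ℝ) ^ (1 / 24 : ℝ)) ∧
                 (∀ r ∈ Set.Icc s (s + τ), ∀ x, ρ r x * σ ^ 3 ≤ η₁) ∧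
                 (∀ r ∈ Set.Icc s (s + τ), (n N : ℝ)⁻¹ * ∑ i, ‖((Φ N).flow r z i).2‖ ^ 4 ≤ K) ∧
                 δ < |Et (s + τ) (φ (s + τ)) - Et s (φ s) - ∫ r in s..(s + τ),
                   (Et r (Torus.timeDerivWithin (Set.Icc s (s + τ)) φ r) +
                    ∫ x, (e r x + p r x) * (∑ i, (m r x i / ρ r x) * (Torus.gradient (φ r) x) i))|}
            ≤ ENNReal.ofReal (Real.exp (-(c₀ * n N)))) →
    (∀ η₁ : ℝ, 0 < η₁ → ∀ (a₀ θ₀ : T3 → ℝ) (u₀ : T3 → V3), Continuous a₀ → Continuous θ₀ → Continuous u₀ →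
        (∀ x, 0 < a₀ x) → (∀ x, 0 < θ₀ x) → ∃ σ₀ : ℝ, 0 < σ₀ ∧ ∀ σ : ℝ, 0 < σ → σ < σ₀ →
        ∀ (ε : ℕ → ℝ) (n : ℕ → ℕ), (∀ N, 0 < ε N) → Tendsto ε atTop (nhds 0) →
        Tendsto (fun N => (n N : ℝ) * ε N ^ 3) atTop (nhds (σ ^ 3)) →
        ∀ (T : ℝ) (ρ θ : ℝ → T3 → ℝ) (u : ℝ → T3 → V3), IsHardSphereEulerSolution σ T ρ u θ →
        ∀ Φ : (N : ℕ) → HardSphereFlow (Torus.geometry (Fin 3)) (ε N) (n N),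
        let P : (N : ℕ) → Measure (Config (n N) (Fin 3) T3) := fun N =>
          particleLaw (Φ N) (canonicalDensity (Torus.geometry (Fin 3)) (ε N) (n N) (localGibbsProfile a₀ u₀ θ₀));
        (∀ N, IsProbabilityMeasure (P N)) →
        (∀ χ : T3 → ℝ, Continuous χ → ∀ δ : ℝ, 0 < δ →
          Tendsto (fun N => P N {z | δ < |empiricalDensityField ((Φ N).flow 0 z) χ - ∫ x, χ x * ρ 0 x|}) atTop (nhds 0) ∧
          Tendsto (fun N => P N {z | δ < ‖empiricalMomentumField ((Φ N).flow 0 z) χ - ∫ x, (χ x * ρ 0 x) • u 0 x‖}) atTop (nhds 0) ∧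
          Tendsto (fun N => P N {z | δ < |empiricalEnergyField ((Φ N).flow 0 z) χ -
            ∫ x, χ x * totalEnergyDensity (ρ 0 x) (u 0 x) (θ 0 x)|}) atTop (nhds 0)) →
        ∀ t ∈ Set.Ico 0 T, (∀ s ∈ Set.Icc 0 t, ∀ x, ρ s x * σ ^ 3 ≤ η₁ / 2) →
          Tendsto (fun N => P N {z | ∃ r ∈ Set.Icc 0 t, ∃ i, (n N : ℝ) ^ (1 / 24 : ℝ) < ‖((Φ N).flow r z i).2‖})
            atTop (nhds 0) ∧
          Tendsto (fun N => P N {z | ∃ r ∈ Set.Icc 0 t, ∃ x : T3,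
            η₁ < empiricalDensityField ((Φ N).flow r z)
              (fun y => if Torus.euclidDist x y < (n N : ℝ) ^ (-(1 / 4 : ℝ))
                then (4 / 3 * Real.pi * ((n N : ℝ) ^ (-(1 / 4 : ℝ))) ^ 3)⁻¹ else 0) * σ ^ 3}) atTop (nhds 0) ∧
          (∃ a : ℝ, 0 < a ∧ ∃ A : ℝ, ∀ᶠ N : ℕ in atTop, ∀ s ∈ Set.Icc 0 t,
            ∫⁻ z, ENNReal.ofReal ((n N : ℝ)⁻¹ * ∑ i : Fin (n N), Real.exp (a * ‖((Φ N).flow s z i).2‖ ^ 2)) ∂(P N) ≤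
              ENNReal.ofReal A)) →
    (∀ (a₀ θ₀ : T3 → ℝ) (u₀ : T3 → V3), Continuous a₀ → Continuous θ₀ → Continuous u₀ →
        (∀ x, 0 < a₀ x) → (∀ x, 0 < θ₀ x) → ∃ σ₀ : ℝ, 0 < σ₀ ∧ ∀ σ : ℝ, 0 < σ → σ < σ₀ →
        ∀ (ε : ℕ → ℝ) (n : ℕ → ℕ), (∀ N, 0 < ε N) → Tendsto ε atTop (nhds 0) →
        Tendsto (fun N => (n N : ℝ) * ε N ^ 3) atTop (nhds (σ ^ 3)) →
        ∀ (T : ℝ) (ρ θ : ℝ → T3 → ℝ) (u : ℝ → T3 → V3), IsHardSphereEulerSolution σ T ρ u θ →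
        ∀ Φ : (N : ℕ) → HardSphereFlow (Torus.geometry (Fin 3)) (ε N) (n N),
        let P : (N : ℕ) → Measure (Config (n N) (Fin 3) T3) := fun N =>
          particleLaw (Φ N) (canonicalDensity (Torus.geometry (Fin 3)) (ε N) (n N) (localGibbsProfile a₀ u₀ θ₀));
        (∀ N, IsProbabilityMeasure (P N)) →
        (∀ χ : T3 → ℝ, Continuous χ → ∀ δ : ℝ, 0 < δ →
          Tendsto (fun N => P N {z | δ < |empiricalDensityField ((Φ N).flow 0 z) χ - ∫ x, χ x * ρ 0 x|}) atTop (nhds 0) ∧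
          Tendsto (fun N => P N {z | δ < ‖empiricalMomentumField ((Φ N).flow 0 z) χ - ∫ x, (χ x * ρ 0 x) • u 0 x‖}) atTop (nhds 0) ∧
          Tendsto (fun N => P N {z | δ < |empiricalEnergyField ((Φ N).flow 0 z) χ -
            ∫ x, χ x * totalEnergyDensity (ρ 0 x) (u 0 x) (θ 0 x)|}) atTop (nhds 0)) →
        ∀ t ∈ Set.Ico 0 T, ∀ K : ℝ,
          (∀ s ∈ Set.Icc 0 t, ∀ x, ‖u s x‖ ^ 4 + 10 * θ s x * ‖u s x‖ ^ 2 + 15 * θ s x ^ 2 < K) →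
          Tendsto (fun N => P N {z | ∃ r ∈ Set.Icc 0 t,
            K < (n N : ℝ)⁻¹ * ∑ i : Fin (n N), ‖((Φ N).flow r z i).2‖ ^ 4}) atTop (nhds 0)) →
    NearConstantShortTimeHL :=
  fun h₁ h₂ h₃ h₄ =>
    nearConstantShortTimeHL_of_dynamics4 (momentumClosureTightness4_inlined_iff.1 h₁)
      (energyClosureTightness4_inlined_iff.1 h₂) (trueLawCapsG_inlined_iff.1 h₃) (fourthMomentCapPreShock_inlined_iff.1 h₄)

end Summit.AtomisticToContinuum.HydrodynamicLimit.Theorems.NearConstantShortTimeHL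

end
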